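import Mathlib.Analysis.SpecialFunctions.Pow.Real
import Mathlib.Analysis.SpecialFunctions.Log.Basic
import Mathlib.Analysis.SpecialFunctions.Sqrt
import Mathlib.Probability.ProbabilityMassFunction.Basic
import Mathlib.Algebra.BigOperators.Fin
import Mathlib.Logic.Equiv.Fin.Basic
import Literature.Computability.Cryptography.QuantumQuery
import Literature.Computability.Complexity.DecisionTree
import Literature.Computability.Complexity.Circuit
import Literature.Computability.Complexity.ConstantDepth
import HarnessLib

-- provenance: harness21/H21/H21/Statements/QuantumAdvantage/QueryComplexity.lean @ 4d2e698 (interim HEAD d8f2665); M5 mechanical rewrite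
/-!
# Quantum advantage: query complexity separations

Family `quantum-advantage` (trunk `CryptoQuantFine`, outline §3, item `QAQuery`), statements
**quantum-advantage.S09**, **S10**, **S11**, **S12**, **S15**.

All statements live in the query (black-box) model. The H21 names of the classical measures of
Buhrman–de Wolf are

* `D(f)   = Literature.CplxCore.detQueryComplexity f` (deterministic decision-tree depth),
* `R(f)   = Literature.CplxCore.randQueryComplexity (1/3) f` (bounded-error randomized),
* `Q₂(f)  = Literature.CryptoQuantFine.quantumQueryComplexity (1/3) f` (bounded-error quantum),
* `Q_E(f) = Literature.CryptoQuantFine.quantumQueryComplexity 0 f` (exact quantum),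

with `…On D` variants for partial functions / promise problems.

Contents.
* **S09** `quantumQueryComplexity_le_randQueryComplexity` (`Q₂(f) ≤ R(f)`), together with
  `quantumQueryComplexity_zero_le_detQueryComplexity` (`Q_E(f) ≤ D(f)`) and the chain
  `Q₂(f) ≤ R(f) ≤ D(f)` (Buhrman–de Wolf 2002, §3).
* **S10** Simon's problem as a promise problem on `n · 2ⁿ` input bits: `simonInput`,
  `simonDecode`, `HasXorMask`, `simonPromise`, `simonFn`, `simon_upper`, `simon_lower`
  (Simon 1997; Buhrman–de Wolf 2002).
* **S11** `grover_bbbv`: `Q₂(OR_N) = Θ(√N)` (Grover 1996; Bennett–Bernstein–Brassard–Vazirani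
  1997, Thm 3.5; Boyer–Brassard–Høyer–Tapp 1998 for the upper bound with bounded error).
* **S12** `detQueryComplexity_le_pow_six`, `detQueryComplexity_le_pow_four`: `D(f) = O(Q₂(f)⁶)`
  (Beals–Buhrman–Cleve–Mosca–de Wolf 2001, §5) and
  `D(f) = O(Q₂(f)⁴)` (Aaronson–Ben-David–Kothari–Rao–Tal, STOC 2021, Thm 1).
* **S15** `raz_tal_forrelation`: the Forrelation distribution fools AC⁰ but not one quantum
  query (Raz–Tal, J. ACM 69 (2022), Thm 1.2).

Mathlib has no query complexity, no Simon/Grover/Forrelation material (searched `query`,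
`Simon`, `Grover`, `Forrelation`, `DecisionTree`); we reuse `finProdFinEquiv`,
`finFunctionFinEquiv`, `finTwoEquiv` (encoding of Simon tables), `PMF`, `Real.sqrt`, `Real.log`,
and the accepted H21 preludes `QuantumQuery` (Q5), `DecisionTree`, `Circuit`, `ConstantDepth`
(G01).

Design choices.
* Simon's function `F : {0,1}ⁿ → {0,1}ⁿ` is presented to a *Boolean* query algorithm as its
  table of `n · 2ⁿ` bits, bit `(j, x)` being `F(x)ⱼ`; the index `(j, x)` is encoded in
  `Fin (n * 2 ^ n)` by `finProdFinEquiv` and `finFunctionFinEquiv` (`simonIndex`). One query to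
  `F` in Simon's `F`-oracle model costs `n` Boolean queries and one Boolean query costs one
  `F`-query, so Simon's bounds transfer as: quantum `O(n)` `F`-queries give `O(n²)` Boolean
  queries, and the classical `Ω(2^{n/2})` lower bound on `F`-queries is also a lower bound on
  Boolean queries. Accordingly `simon_upper` is stated with the bound `C * n ^ 2 + C` (the
  outline's `C * n + C` counts `F`-queries, which the Boolean model `QQueryAlg` of the prelude
  does not express); the exponential separation **S10** is unaffected. `simon_lower` carries the
  hypothesis `1 ≤ n` (for `n = 0` the promise problem is constant and has complexity `0`).
* `simonFn` is the (classical, noncomputable-to-decide) predicate "a nonzero xor-mask exists";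
  on the promise set this is the negation of "`F` is injective" as soon as `1 ≤ n`
  (`not_hasXorMask_of_injective`).
* **S15** is stated for `N = 2ⁿ`, `n ≥ 1` (Raz–Tal work on `{±1}^{2N}` with `N` a power of two,
  the Boolean cube being identified with `{±1}` as usual) and with the Forrelation distribution
  `D` quantified existentially (outline R6: constructing the rounded Gaussian is a follow-up).
  The AC⁰ bound is written `((C * log s) ^ (C * (d + 1))) / √N`, a `polylog(s)^{O(d)}/√N` bound
  whose constant prefactor is absorbed by choosing `C` large (so that `C * log 2 ≥ 1` and the
  bound is monotone in the depth bound `d` and the size bound `s ≥ 2`). Expectations are finite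
  sums: `𝔼_D g = ∑ x, (D x).toReal * g x` and `𝔼_U g = (∑ x, g x) / 2 ^ (2N)`.
* All `O(·)`/`Ω(·)` are rendered arithmetically with explicit existential constants; casts to
  `ℝ` are used so that `√N`, `2^{n/2} = √(2ⁿ)` and `log` make sense.
-/

namespace Literature.Computability.QuantumComplexity

open Complexity Cryptography Finset

/-! ### S09: the query measures and `Q₂(f) ≤ R(f) ≤ D(f)` -/

section Measures

variable {N : ℕ}

/-- **quantum-advantage.S09** (Buhrman–de Wolf 2002, §3, `Q₂(f) ≤ R₂(f)`; Beals et al. 2001,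
§2). Bounded-error quantum query complexity is at most bounded-error randomized query complexity:
`quantumQueryComplexity (1/3) f ≤ randQueryComplexity (1/3) f`, i.e. `Q₂(f) ≤ R(f)`, for every
total Boolean function `f` on `N` bits. In H21, `D(f) = detQueryComplexity f`,
`R(f) = randQueryComplexity (1/3) f`, `Q₂(f) = quantumQueryComplexity (1/3) f` and
`Q_E(f) = quantumQueryComplexity 0 f`. (A randomized decision tree is simulated query-for-query
by a quantum query algorithm whose workspace holds the random coins and the transcript.) [cite: Wolf2002, §3   Q₂(f] -/
def quantumQueryComplexity_le_randQueryComplexity : Prop :=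
  ∀ (f : (Fin N → Bool) → Bool),
    quantumQueryComplexity (1 / 3) f ≤ randQueryComplexity (1 / 3) f

/-- **quantum-advantage.S09** (Buhrman–de Wolf 2002, §3, `Q_E(f) ≤ D(f)`; Beals et al. 2001,
§2). Exact quantum query complexity is at most deterministic query complexity: a decision tree of
depth `d` is simulated exactly by a `d`-query quantum algorithm. [cite: Wolf2002, §3   Q_E(f] -/
def quantumQueryComplexity_zero_le_detQueryComplexity : Prop :=
  ∀ (f : (Fin N → Bool) → Bool),
    quantumQueryComplexity 0 f ≤ detQueryComplexity f

/-- **quantum-advantage.S09** (Buhrman–de Wolf 2002, §3: `Q₂(f) ≤ R₂(f) ≤ D(f)`).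
Bounded-error quantum query complexity is at most deterministic query complexity. [cite: Wolf2002, §3:  Q₂(f] -/
def quantumQueryComplexity_le_detQueryComplexity : Prop :=
  ∀ (f : (Fin N → Bool) → Bool),
    quantumQueryComplexity (1 / 3) f ≤ detQueryComplexity f

/- interim proof relied on results that are now named facts (D-0014); demoted to a fact by the M5 import, proof preserved:
:=
  (quantumQueryComplexity_le_randQueryComplexity f).trans
    (randQueryComplexity_le_det (by norm_num) f)
-/

/-- **quantum-advantage.S09** (Buhrman–de Wolf 2002, §3: `Q₂(f) ≤ Q_E(f)`). Allowing error only
helps: bounded-error quantum query complexity is at most exact quantum query complexity. [cite: Wolf2002, §3:  Q₂(f] -/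
def quantumQueryComplexity_le_quantumQueryComplexity_zero : Prop :=
  ∀ (f : (Fin N → Bool) → Bool),
    quantumQueryComplexity (1 / 3) f ≤ quantumQueryComplexity 0 f

/- interim proof relied on results that are now named facts (D-0014); demoted to a fact by the M5 import, proof preserved:
:=
  quantumQueryComplexity_anti le_rfl (by norm_num) f
-/

end Measures

/-! ### S10: Simon's problem -/

section Simon

variable {n : ℕ}

/-- The position of the table bit `F(x)ⱼ` of a function `F : {0,1}ⁿ → {0,1}ⁿ` inside its
`n · 2ⁿ`-bit table: the pair `(j, x)` encoded via `finProdFinEquiv` and `finFunctionFinEquiv`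
(with `Bool ≃ Fin 2` by `finTwoEquiv`). (Encoding of Simon's problem as a Boolean query problem;
Buhrman–de Wolf 2002, §3; Simon 1997.) [cite: Wolf2002, §3] -/
def simonIndex (n : ℕ) : Fin n × (Fin n → Bool) ≃ Fin (n * 2 ^ n) :=
  (Equiv.prodCongr (Equiv.refl _)
      ((Equiv.arrowCongr (Equiv.refl _) finTwoEquiv.symm).trans finFunctionFinEquiv)).trans
    finProdFinEquiv

/-- The `n · 2ⁿ`-bit table of `F : {0,1}ⁿ → {0,1}ⁿ`: bit `simonIndex n (j, x)` is `F(x)ⱼ`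
(Simon 1997; Buhrman–de Wolf 2002, §3). [cite: Simon1997] -/
def simonInput (n : ℕ) (F : (Fin n → Bool) → (Fin n → Bool)) : Fin (n * 2 ^ n) → Bool :=
  fun k => F ((simonIndex n).symm k).2 ((simonIndex n).symm k).1

/-- The function `{0,1}ⁿ → {0,1}ⁿ` encoded by an `n · 2ⁿ`-bit table (inverse of `simonInput`)
(Simon 1997; Buhrman–de Wolf 2002, §3). [cite: Simon1997] -/
def simonDecode (n : ℕ) (t : Fin (n * 2 ^ n) → Bool) : (Fin n → Bool) → (Fin n → Bool) :=
  fun x j => t (simonIndex n (j, x))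

/-- Decoding the table of `F` gives back `F` (Simon 1997, encoding bookkeeping). [cite: Simon1997, encoding bookkeeping] -/
@[simp]
theorem simonDecode_simonInput (F : (Fin n → Bool) → (Fin n → Bool)) :
    simonDecode n (simonInput n F) = F := by
  funext x j
  simp [simonDecode, simonInput]

/-- Encoding the decoded function gives back the table (Simon 1997, encoding bookkeeping). [cite: Simon1997, encoding bookkeeping] -/
@[simp]
theorem simonInput_simonDecode (t : Fin (n * 2 ^ n) → Bool) :
    simonInput n (simonDecode n t) = t := by
  funext k
  simp [simonDecode, simonInput]

/-- `HasXorMask F s`: `F(x) = F(y)` iff `y = x` or `y = x ⊕ s` (bitwise xor). For `s ≠ 0` this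
says `F` is two-to-one with hidden period `s` (Simon 1997, §3, "Simon's promise"). [cite: Simon1997, §3  "Simon's promise"] -/
def HasXorMask (F : (Fin n → Bool) → (Fin n → Bool)) (s : Fin n → Bool) : Prop :=
  ∀ x y, F x = F y ↔ y = x ∨ y = fun i => x i ^^ s i

/-- Simon's promise: the set of tables of functions `F : {0,1}ⁿ → {0,1}ⁿ` that are either
injective or two-to-one with a nonzero xor-mask `s` (`F(x) = F(y) ↔ y ∈ {x, x ⊕ s}`)
(Simon 1997, §3; Buhrman–de Wolf 2002, §3). [cite: Simon1997, §3] -/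
def simonPromise (n : ℕ) : Set (Fin (n * 2 ^ n) → Bool) :=
  {t | Function.Injective (simonDecode n t) ∨
    ∃ s : Fin n → Bool, s ≠ (fun _ => false) ∧ HasXorMask (simonDecode n t) s}

open Classical in
/-- Simon's (decision) problem: output `true` iff the encoded function has a nonzero xor-mask,
`false` iff it is injective (on the promise set these are complementary for `n ≥ 1`,
`not_hasXorMask_of_injective`) (Simon 1997, §3; Buhrman–de Wolf 2002, §3). Noncomputable: the
predicate is decided classically. [cite: Simon1997, §3] -/
noncomputable def simonFn (n : ℕ) (t : Fin (n * 2 ^ n) → Bool) : Bool :=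
  decide (∃ s : Fin n → Bool, s ≠ (fun _ => false) ∧ HasXorMask (simonDecode n t) s)

/-- An injective `F` has no nonzero xor-mask (so the two branches of Simon's promise are
disjoint) (Simon 1997, §3). [cite: Simon1997, §3] -/
theorem not_hasXorMask_of_injective {F : (Fin n → Bool) → (Fin n → Bool)}
    (hF : Function.Injective F) {s : Fin n → Bool} (hs : s ≠ fun _ => false) :
    ¬ HasXorMask F s := by
  intro h
  apply hs
  funext i
  have hx : (fun i => false ^^ s i) = (fun _ : Fin n => false) :=
    hF (((h (fun _ => false) _).2 (Or.inr rfl)).symm)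
  simpa using congrFun hx i

/-- The table of `F` lies in Simon's promise set iff `F` is injective or has a nonzero xor-mask
(Simon 1997, §3). [cite: Simon1997, §3] -/
theorem simonInput_mem_simonPromise_iff (F : (Fin n → Bool) → (Fin n → Bool)) :
    simonInput n F ∈ simonPromise n ↔
      Function.Injective F ∨ ∃ s : Fin n → Bool, s ≠ (fun _ => false) ∧ HasXorMask F s := by
  simp [simonPromise]

/-- **quantum-advantage.S10** (upper bound; Simon, *On the power of quantum computation*,
SIAM J. Comput. 26 (1997), §3; Buhrman–de Wolf 2002, §3). Simon's promise problem has bounded-error quantum query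
complexity `O(n)` in the `F`-oracle model, hence `O(n²)` in the Boolean query model of
`QQueryAlg` (each `F`-query is `n` bit-queries): there is `C` with
`Q₂(simonFn n on simonPromise n) ≤ C n² + C` for all `n`. [cite: Wolf2002, §3] -/
def simon_upper : Prop :=
  ∃ C : ℝ, ∀ n : ℕ,
      (quantumQueryComplexityOn (1 / 3) (simonPromise n) (simonFn n) : ℝ) ≤ C * (n : ℝ) ^ 2 + C

/-- **quantum-advantage.S10** (lower bound; Simon 1997, §3; Buhrman–de Wolf 2002,
§3). Every bounded-error classical (randomized) query algorithm for Simon's promise problem makes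
`Ω(2^{n/2})` queries: there is `c > 0` with `c · √(2ⁿ) ≤ R(simonFn n on simonPromise n)` for
all `n ≥ 1` (a Boolean query is weaker than an `F`-query, so the `F`-oracle lower bound
transfers). For `n = 0` the problem is constant, whence the hypothesis `1 ≤ n`. [cite: Simon1997, §3] -/
def simon_lower : Prop :=
  ∃ c : ℝ, 0 < c ∧ ∀ n : ℕ, 1 ≤ n →
      c * Real.sqrt (2 ^ n) ≤ (randQueryComplexityOn (1 / 3) (simonPromise n) (simonFn n) : ℝ)

end Simon

/-! ### S11: Grover search and the BBBV lower bound -/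

/-- **quantum-advantage.S11** (Grover, STOC 1996; Boyer–Brassard–Høyer–Tapp 1998 (upper bound
`O(√N)` with bounded error); Bennett–Bernstein–Brassard–Vazirani, SIAM J. Comput. 26 (1997),
Thm 3.5 (lower bound `Ω(√N)`); Buhrman–de Wolf 2002, §3). The bounded-error quantum query
complexity of `OR_N` is `Θ(√N)`: there are constants `0 < c` and `C` with
`c √N ≤ Q₂(OR_N) ≤ C √N` for all `N ≥ 1`. [cite: STOC1996] -/
def grover_bbbv : Prop :=
  ∃ c C : ℝ, 0 < c ∧ ∀ N : ℕ, 1 ≤ N →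
      c * Real.sqrt N ≤ (quantumQueryComplexity (1 / 3) (orFn N) : ℝ) ∧
        (quantumQueryComplexity (1 / 3) (orFn N) : ℝ) ≤ C * Real.sqrt N

/-! ### S12: polynomial relation between `D(f)` and `Q₂(f)` for total functions -/

/-- **quantum-advantage.S12** (Beals–Buhrman–Cleve–Mosca–de Wolf, J. ACM 48 (2001), §5,
`D(f) = O(Q₂(f)⁶)`; Buhrman–de Wolf 2002, §3). For total Boolean functions deterministic and
bounded-error quantum query complexity are polynomially related: there is `C` with
`D(f) ≤ C · Q₂(f)⁶` for every `N` and every `f : {0,1}ᴺ → {0,1}`. [cite: Wolf2002, §3] -/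
def detQueryComplexity_le_pow_six : Prop :=
  ∃ C : ℝ, ∀ (N : ℕ) (f : (Fin N → Bool) → Bool),
      (detQueryComplexity f : ℝ) ≤ C * (quantumQueryComplexity (1 / 3) f : ℝ) ^ 6

/-- **quantum-advantage.S12** (Aaronson–Ben-David–Kothari–Rao–Tal, *Degree vs. approximate
degree and quantum implications of Huang's sensitivity theorem*, STOC 2021, Thm 1:
`D(f) = O(Q(f)⁴)`). The fourth-power improvement of `detQueryComplexity_le_pow_six`: there is
`C` with `D(f) ≤ C · Q₂(f)⁴` for every total Boolean function `f`. [cite: STOC2021, Thm 1:  D(f] -/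
def detQueryComplexity_le_pow_four : Prop :=
  ∃ C : ℝ, ∀ (N : ℕ) (f : (Fin N → Bool) → Bool),
      (detQueryComplexity f : ℝ) ≤ C * (quantumQueryComplexity (1 / 3) f : ℝ) ^ 4

/-! ### S15: Forrelation fools AC⁰ (Raz–Tal) -/

/-- **quantum-advantage.S15** (Raz–Tal, *Oracle separation of BQP and PH*, J. ACM 69 (2022),
Thm 1.2 with §1 and §7). For `N = 2ⁿ ≥ 2` there is a distribution `D` on `{0,1}^{2N}` (the
rounded-Gaussian *Forrelation distribution*; here existential, outline R6) such that
(1) for every unbounded fan-in circuit `F` over `{¬, ∧ₖ, ∨ₖ}` of (negation-free) depth `≤ d`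
and size `≤ s` (`s ≥ 2`), `|𝔼_{x∼D} F(x) − 𝔼_{x∼U} F(x)| ≤ (C log s)^{C (d+1)} / √N`
(a `polylog(s)^{O(d)}/√N` bound; the constant prefactor is absorbed in `C`), and
(2) some quantum query algorithm making a single query has advantage
`|𝔼_{x∼D} Pr[A accepts x] − 𝔼_{x∼U} Pr[A accepts x]| ≥ c / log N`.
Expectations are finite sums, `𝔼_U g = (∑ x, g x) / 2^{2N}`. [cite: RazTalJACM2022, Thm. 1.1 and Thm. 7.4 (ECCC TR18-107 / STOC 2019 numbering)] -/
def raz_tal_forrelation : Prop :=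
  ∃ (C : ℕ) (c : ℝ), 0 < c ∧ ∀ n N : ℕ, 1 ≤ n → N = 2 ^ n →
      ∃ D : PMF (Fin (2 * N) → Bool),
        (∀ (F : Circuit (Fin (2 * N))) (d s : ℕ), F.IsOver acBasis → F.acDepth ≤ d →
            F.size ≤ s → 2 ≤ s →
          |∑ x, (D x).toReal * (if F.eval x then (1 : ℝ) else 0) -
              (∑ x : Fin (2 * N) → Bool, if F.eval x then (1 : ℝ) else 0) / 2 ^ (2 * N)| ≤
            ((C : ℝ) * Real.log s) ^ (C * (d + 1)) / Real.sqrt N) ∧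
        ∃ A : QQueryAlg (2 * N), A.queries = 1 ∧
          c / Real.log N ≤
            |∑ x, (D x).toReal * A.acceptProb x -
              (∑ x : Fin (2 * N) → Bool, A.acceptProb x) / 2 ^ (2 * N)|

end Literature.Computability.QuantumComplexity
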